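import Summits.CriticalPhenomena.CardyFormulaZ2.Theorems.CardyWickAnisotropyBoxFamilyToCardyKnownHalfSS
import Summits.CriticalPhenomena.CardyFormulaZ2.Theorems.CardyWickAnisotropyBoxFamilyToCardyStubDomainContinuity
import Summits.CriticalPhenomena.CardyFormulaZ2.Theorems.CardyWickAnisotropyBoxFamilyToCardyStubRectilinearRealisation
import HarnessLib

/-!
# Crux `BoxFamilyToCardy` (stmt-CriticalPhenomena-14215): the crux, and the shared transport crux, reduced to the rectilinear heart

Route `CardyWickAnisotropy` of `CardyFormulaZ2`, crux `BoxFamilyToCardy : AnisotropicBoxCardy →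
CardyFormulaZ2` (line `Cruxes/BoxFamilyToCardy/Lines/birth.lean`, lead c3, 2026-08-17). The open half
of the crux — conformal invariance of bond-`ℤ²` crossing limits in transport form, the shared sibling
crux `CardyMonotoneApproach.ConfInvTransport` (stmt-CriticalPhenomena-0794) — was cut by that crux's
registered line into three limit-free stubs: S1 `stub_rectilinearInvariance` (asymptotic equality of
the crossing probabilities of RECTILINEAR conformal rectangles of equal modulus — the conformal
content, open), S2 `stub_domainContinuity` (mesh-uniform continuity of `bondDomainCrossingProb` in
the marked-loop topology) and S3 `stub_rectilinearRealisation` (exact-modulus rectilinear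
approximants). S2 and S3 are now THEOREMS of the tree
(`CardyWickAnisotropyBoxFamilyToCardyStubDomainContinuity{,Part1,Part2,Part3}.lean`, p158922 etc.;
`CardyWickAnisotropyBoxFamilyToCardyStubRectilinearRealisation.lean`, p157265). This file records the
consequences, sorry-free:

* `tendsto_of_approximants` — the four-corner transport of a limit (bookkeeping; the sibling
  skeleton's lemma);
* `confInvTransport_of_rectilinearInvariance` — **the shared crux stmt-0794 from its heart S1 alone**:
  S1 ⇒ `ConfInvTransport`;
* `boxFamilyToCardy_of_thm21SS_of_rectilinearInvariance` — **this crux from its two open stubs**: the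
  printed DKKMO 2020 Thm 2.1 (`d_SS` half, named fact `DKKMO2020_thm21_schrammSmirnov`, the route's
  needs-fact debt) and S1 imply `BoxFamilyToCardy` (via lead c2's
  `boxFamilyToCardy_of_thm21SS_of_confInvTransport`).

S1 is spelled out verbatim as a hypothesis (it is the registered stub statement; no definition is
introduced). No named fact is taken as an axiom.

References: O. Schramm, Proc. ICM 2006, §2.6 Problem 2.11; DKKMO, arXiv:2012.11672, Thm. 2.1;
Ch. Pommerenke, *Boundary Behaviour of Conformal Maps* (1992), Thm. 2.11; O. Schramm, S. Smirnov,
Ann. Probab. 39 (2011), Lemma 5.1.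
-/

noncomputable section

open Filter Topology Set
open Literature.Probability.RandomPlanarGeometry
open Literature.Probability.Percolation (bondDomainCrossingProb DKKMO2020_thm21_schrammSmirnov)
open Summit.CriticalPhenomena.CardyFormulaZ2.Theses.CardyWickAnisotropy (AnisotropicBoxCardy
  BoxFamilyToCardy)
open Summit.CriticalPhenomena.CardyFormulaZ2.Theses.CardyMonotoneApproach (ConfInvTransport)

namespace Summit.CriticalPhenomena.CardyFormulaZ2.Cruxes.BoxFamilyToCardy.Birth

/-- **Four-corner transport of a limit.** Let `p, p' : ℝ → ℝ` and a filter `l`. Suppose that for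
every `τ > 0` there are `a, a' : ℝ → ℝ` with, `l`-eventually, `|a - p| ≤ τ` and `|a' - p'| ≤ τ`, and
`a - a' → 0` along `l`. If `p → L` along `l` then `p' → L` along `l`: eventually
`|p' - L| ≤ |p' - a'| + |a' - a| + |a - p| + |p - L| < 4τ`. (The bookkeeping lemma of the sibling
skeleton `Cruxes/ConfInvTransport/Lines/birth.lean`.) [folklore] -/
theorem tendsto_of_approximants {l : Filter ℝ} {p p' : ℝ → ℝ} {L : ℝ}
    (h : ∀ τ : ℝ, 0 < τ → ∃ a a' : ℝ → ℝ, (∀ᶠ δ in l, |a δ - p δ| ≤ τ) ∧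
      (∀ᶠ δ in l, |a' δ - p' δ| ≤ τ) ∧ Tendsto (fun δ ↦ a δ - a' δ) l (𝓝 0))
    (hp : Tendsto p l (𝓝 L)) : Tendsto p' l (𝓝 L) := by
  rw [Metric.tendsto_nhds]
  intro τ hτ
  have hτ4 : 0 < τ / 4 := by positivity
  obtain ⟨a, a', ha, ha', haa'⟩ := h (τ / 4) hτ4
  have h3 : ∀ᶠ δ in l, dist (a δ - a' δ) 0 < τ / 4 := Metric.tendsto_nhds.1 haa' _ hτ4
  have h4 : ∀ᶠ δ in l, dist (p δ) L < τ / 4 := Metric.tendsto_nhds.1 hp _ hτ4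
  filter_upwards [ha, ha', h3, h4] with δ h1 h2 h3 h4
  rw [Real.dist_eq, sub_zero] at h3
  rw [Real.dist_eq] at h4 ⊢
  obtain ⟨h1l, h1r⟩ := abs_le.1 h1
  obtain ⟨h2l, h2r⟩ := abs_le.1 h2
  obtain ⟨h3l, h3r⟩ := abs_lt.1 h3
  obtain ⟨h4l, h4r⟩ := abs_lt.1 h4
  exact abs_lt.2 ⟨by linarith, by linarith⟩

/-- **The shared transport crux from its rectilinear heart alone.** If (S1) rectilinear conformal
rectangles `Q, Q'` (Jordan boundary inside finitely many axis-parallel segments) with uniformizing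
data of equal Cardy cross-ratio have asymptotically equal bond-`ℤ²` crossing probabilities,
`bondDomainCrossingProb Q δ - bondDomainCrossingProb Q' δ → 0` as `δ → 0⁺`, then conformal
invariance of bond-`ℤ²` crossing limits holds in transport form for ALL pairs of conformal
rectangles (`CardyMonotoneApproach.ConfInvTransport`, stmt-CriticalPhenomena-0794, by name). Proof:
for `R, R'` of common modulus `η` with `P_δ(R) → L` and `τ > 0`, mesh-uniform domain continuity
(`stub_domainContinuity`, S2, proved) gives closeness scales at `R` and `R'`, exact-modulus
rectilinear realisation (`stub_rectilinearRealisation`, S3, proved) gives rectilinear `Q`, `Q'` that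
close, both of modulus exactly `η`, S1 gives `P_δ(Q) - P_δ(Q') → 0`, and `tendsto_of_approximants`
transports the limit. [cite: Schramm2007ICM, §2.6 Problem 2.11] -/
theorem confInvTransport_of_rectilinearInvariance : (∀ (Q Q' : Literature.Probability.RandomPlanarGeometry.ConformalRectangle), (∃ S : Finset (ℂ × ℂ), (∀ p ∈ S, p.1.re = p.2.re ∨ p.1.im = p.2.im) ∧ frontier Q.carrier ⊆ ⋃ p ∈ S, segment ℝ p.1 p.2) → (∃ S : Finset (ℂ × ℂ), (∀ p ∈ S, p.1.re = p.2.re ∨ p.1.im = p.2.im) ∧ frontier Q'.carrier ⊆ ⋃ p ∈ S, segment ℝ p.1 p.2) → ∀ (ψ : Literature.Probability.RandomPlanarGeometry.ConformalEquiv UpperHalfPlane.upperHalfPlaneSet Q.carrier) (y : Fin 4 → ℝ) (ψ' : Literature.Probability.RandomPlanarGeometry.ConformalEquiv UpperHalfPlane.upperHalfPlaneSet Q'.carrier) (y' : Fin 4 → ℝ), Q.IsUniformizing ψ y → Q'.IsUniformizing ψ' y' → Literature.Probability.RandomPlanarGeometry.crossRatio y = Literature.Probability.RandomPlanarGeometry.crossRatio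 y' → Filter.Tendsto (fun δ : ℝ ↦ Literature.Probability.Percolation.bondDomainCrossingProb Q δ - Literature.Probability.Percolation.bondDomainCrossingProb Q' δ) (nhdsWithin (0 : ℝ) (Set.Ioi 0)) (nhds 0)) → Summit.CriticalPhenomena.CardyFormulaZ2.Theses.CardyMonotoneApproach.ConfInvTransport := by
  intro h₁ R R' φ x φ' x' huni huni' hη L hL
  refine tendsto_of_approximants (fun τ hτ ↦ ?_) hL
  obtain ⟨ε₀, hε₀, hcont⟩ := stub_domainContinuity R τ hτ
  obtain ⟨ε₀', hε₀', hcont'⟩ := stub_domainContinuity R' τ hτ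
  obtain ⟨Q, ψ, y, hQrect, hQuni, hQloop, hQmark, hQη⟩ :=
    stub_rectilinearRealisation R φ x huni ε₀ hε₀
  obtain ⟨Q', ψ', y', hQ'rect, hQ'uni, hQ'loop, hQ'mark, hQ'η⟩ :=
    stub_rectilinearRealisation R' φ' x' huni' ε₀' hε₀'
  have hyy' : crossRatio y = crossRatio y' := by rw [hQη, hQ'η, hη]
  exact ⟨bondDomainCrossingProb Q, bondDomainCrossingProb Q', hcont Q hQloop hQmark,
    hcont' Q' hQ'loop hQ'mark, h₁ Q Q' hQrect hQ'rect ψ y ψ' y' hQuni hQ'uni hyy'⟩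

/-- **The crux from its two open stubs.** The printed DKKMO 2020 Thm. 2.1 (`q = 1`, `d_SS` half —
the named fact `DKKMO2020_thm21_schrammSmirnov`, unproved in the tree) and the rectilinear heart S1
imply `BoxFamilyToCardy : AnisotropicBoxCardy → CardyFormulaZ2`: the known half
(`isotropicRectangles_of_thm21SS`) gives Cardy on every corner-marked rectangle, S1 gives the transport
(`confInvTransport_of_rectilinearInvariance`), and `boxFamilyToCardy_of_thm21SS_of_confInvTransport`
(lead c2) assembles. [cite: DKKMO2020Rotational, Thm. 2.1 (q = 1)] -/
theorem boxFamilyToCardy_of_thm21SS_of_rectilinearInvariance : Literature.Probability.Percolation.DKKMO2020_thm21_schrammSmirnov → (∀ (Q Q' : Literature.Probability.RandomPlanarGeometry.ConformalRectangle), (∃ S : Finset (ℂ × ℂ), (∀ p ∈ S, p.1.re = p.2.re ∨ p.1.im = p.2.im) ∧ frontier Q.carrier ⊆ ⋃ p ∈ S, segment ℝ p.1 p.2) → (∃ S : Finset (ℂ × ℂ), (∀ p ∈ S, p.1.re = p.2.re ∨ p.1.im = p.2.im) ∧ frontier Q'.carrier ⊆ ⋃ p ∈ S, segment ℝ p.1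 p.2) → ∀ (ψ : Literature.Probability.RandomPlanarGeometry.ConformalEquiv UpperHalfPlane.upperHalfPlaneSet Q.carrier) (y : Fin 4 → ℝ) (ψ' : Literature.Probability.RandomPlanarGeometry.ConformalEquiv UpperHalfPlane.upperHalfPlaneSet Q'.carrier) (y' : Fin 4 → ℝ), Q.IsUniformizing ψ y → Q'.IsUniformizing ψ' y' → Literature.Probability.RandomPlanarGeometry.crossRatio y = Literature.Probability.RandomPlanarGeometry.crossRatio y' → Filter.Tendsto (fun δ : ℝ ↦ Literature.Probability.Percolation.bondDomainCrossingProb Q δ - Literature.Probability.Percolation.bondDomainCrossingProb Q' δ) (nhdsWithin (0 : ℝ) (Set.Ioi 0)) (nhds 0)) → Summit.CriticalPhenomena.CardyFormulaZ2.Theses.CardyWickAnisotropy.BoxFamilyToCardy :=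
  fun hSS h₁ =>
  boxFamilyToCardy_of_thm21SS_of_confInvTransport hSS (confInvTransport_of_rectilinearInvariance h₁)

/-- **The conjunct from Cardy on corner-marked rectangles and the rectilinear heart** (by-name form
for the sibling route `CardyMonotoneApproach`, whose target is `RectCardy`): if (S1) rectilinear
conformal rectangles of equal modulus have asymptotically equal bond-`ℤ²` crossing probabilities, then
Cardy's formula on every corner-marked axis-parallel rectangle (`RectCardy`, stmt-CriticalPhenomena-5843)
implies Cardy's formula for every conformal rectangle of bond-`ℤ²` (`CardyFormulaZ2`): realise the
modulus of `R'` by a corner-marked rectangle `R` (`exists_rect_datum_of_mem_Ioo`), read Cardy on `R`,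
and transport by `confInvTransport_of_rectilinearInvariance`. [cite: Schramm2007ICM, §2.6 Problem 2.11] -/
theorem cardyFormulaZ2_of_rectilinearInvariance_of_rectCardy : (∀ (Q Q' : Literature.Probability.RandomPlanarGeometry.ConformalRectangle), (∃ S : Finset (ℂ × ℂ), (∀ p ∈ S, p.1.re = p.2.re ∨ p.1.im = p.2.im) ∧ frontier Q.carrier ⊆ ⋃ p ∈ S, segment ℝ p.1 p.2) → (∃ S : Finset (ℂ × ℂ), (∀ p ∈ S, p.1.re = p.2.re ∨ p.1.im = p.2.im) ∧ frontier Q'.carrier ⊆ ⋃ p ∈ S, segment ℝ p.1 p.2) → ∀ (ψ : Literature.Probability.RandomPlanarGeometry.ConformalEquiv UpperHalfPlane.upperHalfPlaneSet Q.carrier) (y : Fin 4 → ℝ) (ψ' : Literature.Probability.RandomPlanarGeometry.ConformalEquiv UpperHalfPlane.upperHalfPlaneSet Q'.carrier) (y' : Fin 4 → ℝ), Q.IsUniformizing ψ y → Q'.IsUniformizing ψ' y' → Literature.Probability.RandomPlanarGeometry.crossRatio y = Literature.Probability.RandomPlanarGeometry.crossRatio y' → Filter.Tendsto (fun δ : ℝ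 ↦ Literature.Probability.Percolation.bondDomainCrossingProb Q δ - Literature.Probability.Percolation.bondDomainCrossingProb Q' δ) (nhdsWithin (0 : ℝ) (Set.Ioi 0)) (nhds 0)) → Summit.CriticalPhenomena.CardyFormulaZ2.Theses.CardyMonotoneApproach.RectCardy → CardyFormulaZ2 := by
  intro h₁ hRC R' φ' x' h'
  obtain ⟨R, w, h, φ, x, hw, hh, hcar, hpt, hφx, hη⟩ :=
    exists_rect_datum_of_mem_Ioo (ConformalRectangle.crossRatio_mem_Ioo_of_isUniformizing h')
  have hlim : Tendsto (bondDomainCrossingProb R) (𝓝[>] 0) (𝓝 (cardyFunction (crossRatio x))) :=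
    hRC R w h hw hh hcar hpt φ x hφx
  have hlim' := confInvTransport_of_rectilinearInvariance h₁ R R' φ x φ' x' hφx h' hη _ hlim
  rw [hη] at hlim'
  exact hlim'

end Summit.CriticalPhenomena.CardyFormulaZ2.Cruxes.BoxFamilyToCardy.Birth

end
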